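import Mathlib
import HarnessLib
import Literature.ComputerArithmetic.BrentZimmermann2010.ContourIntegration

/-!
# The Lanczos representation for Fourier coefficients (Davis–Rabinowitz 1984, Sect. 2.10.8)

Davis–Rabinowitz, *Methods of Numerical Integration* (2nd ed., 1984), Sect. 2.10.8 "Use of the Lanczos
Representation" (held OCR PDF pp. 135–136; Lyness). For `f` analytic on a region containing `[0, 1]` and an
integer `p > 1`, `f = h_{p-1} + g_p` with the polynomial
`h_{p-1}(x) = Σ_{q=1}^{p-1} φ^{(q-1)}(0) B_q(x)/q!`, `φ(x) = f(x+1) - f(x)` **(2.10.8.3)** (`B_q` the Bernoulli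
polynomial of (2.9.8)), and a remainder `g_p = f - h_{p-1}` **(2.10.8.4)** whose Fourier coefficients
`C_r g_p`, `S_r g_p` — for any `g`, `C_r g + i S_r g = 2 ∫_0^1 g(x) e^{2π i r x} dx` (`r ≥ 1`) **(2.10.8.1)**,
`C_0 g = I g = ∫_0^1 g`, `S_0 g = 0` **(2.10.8.2)** — decay like `r^{-p}`. Since `I h_{p-1} = 0`,
`I g_p = I f`. With the coefficients of the approximation `f̂` **(2.10.8.5)** in hand, any
`∫_0^1 e^{-γ x} f(x) dx` (`γ` complex) is approximated by `∫_0^1 e^{-γ x} f̂(x) dx`, evaluated analytically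
through `J_q(γ) = ∫_0^1 e^{-γ x} (B_q(x)/q!) dx`: `J_0(0) = 1`, `J_q(0) = 0` (`q ≥ 1`), and for `|γ| > 0`
**(2.10.8.7)** `J_q(γ) = (1 - e^{-γ}) Σ_{l=0, l even}^{q} (B_l/l!) γ^{l-q-1} - (γ^{-q}/2)(e^{-γ} + 1)`
(`B_l` the Bernoulli numbers; the restriction to even `l` only removes `l = 1`), with the small-`γ` alternative
**(2.10.8.8)** `J_q(γ) = -(1 - e^{-γ}) Σ_{l ≥ q+1} (B_l/l!) γ^{l-q-1}`, `|γ| < 2π`.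

What is formalised here (Mathlib only; `B_q(x)` = Mathlib's `bernoulliFun q`):

* the data of the representation: `lanczosLambda f q = f^{(q-1)}(1) - f^{(q-1)}(0)` (`= φ^{(q-1)}(0)`),
  `lanczosPoly f p = h_{p-1}`, `lanczosRemainder f p = g_p`, the unit-interval Fourier functionals
  `unitCosCoeff g r = C_r g`, `unitSinCoeff g r = S_r g` with the conventions (2.10.8.2), and
  `lanczosJ q γ = J_q(γ)` for complex `γ`;
* PROVED: `I h_{p-1} = 0` (`integral_lanczosPoly`, from `∫_0^1 B_q = 0`, `q ≥ 1`) and hence `I g_p = I f`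
  (`integral_lanczosRemainder`); `J_0(0) = 1`, `J_q(0) = 0` for `q ≥ 1` (`lanczosJ_zero_zero`,
  `lanczosJ_zero_of_ne_zero`);
* PROVED: (2.10.8.7) for `q = 1` and every `γ ≠ 0` (`lanczosJ_one`, `lanczosJFormula_one`: an explicit
  antiderivative of `e^{-γx}(x - ½)`); and the case `γ = 2π i n`, `n ≠ 0`, of (2.10.8.7) for all `q ≥ 1` — the one that yields the Fourier coefficients of `f̂`
  ("if `γ = -2π i r` we get the Fourier coefficients"): `J_q(2π i n) = -(2π i n)^{-q}` (`lanczosJ_two_pi_I_mul`,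
  from Mathlib's Fourier coefficients of the Bernoulli functions `bernoulliFourierCoeff_eq`), and that the
  printed right-hand side of (2.10.8.7) takes the same value there (`lanczosJRHS_two_pi_I_mul`,
  `lanczosJFormula_two_pi_I_mul`) because `e^{-γ} = 1`;
* (2.10.8.7) for general `γ ≠ 0` and (2.10.8.8) as NAMED FACTS (`LanczosJFormula`, `LanczosJSmallGamma`), and
  Lyness's decay statement for the coefficients of `g_p` as a NAMED FACT (`LanczosRemainderDecay`) — all
  three PROVED in the appended sections (`LanczosJFormula_holds`, `LanczosRemainderDecay_holds`,
  `LanczosJSmallGamma_holds`).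

Reading note: the OCR of (2.10.8.1) shows a factor "½" before the integral; the expansion (2.10.8.4)
`g = Σ_r C_r g cos 2πrx + S_r g sin 2πrx` forces the factor `2` (so that `C_1(cos 2π·) = 1`), which is what
`unitCosCoeff`/`unitSinCoeff` use. Not formalised: the approximations `λ_q`, `Ĉ_r`, `Ŝ_r` by interpolation /
the trapezoidal rule / FFT, the tabular variant (2.10.8.6). PROVED in the appended sections: (2.10.8.7) for
every `q ≥ 1` and `γ ≠ 0` (`LanczosJFormula_holds`, by the integration-by-parts recurrence `lanczosJ_succ`),
the decay `|C_r g_p|, |S_r g_p| ≤ C/r^p` for smooth `f`, `p ≥ 2` (`LanczosRemainderDecay_holds`, by `p`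
integrations by parts), and (2.10.8.8) for `q ≥ 1`, `0 < |γ| < 2π` (`LanczosJSmallGamma_holds`, from the
tree's analytic Bernoulli generating function, imported from `BrentZimmermann2010/ContourIntegration`).
-/

open Finset MeasureTheory intervalIntegral Complex

namespace Literature.Analysis.Quadrature

/-! ## The data of the representation -/

/-- `λ_q = φ^{(q-1)}(0) = f^{(q-1)}(1) - f^{(q-1)}(0)` where `φ(x) = f(x+1) - f(x)` (for `f` smooth on a
neighbourhood of `[0, 1]` the two descriptions agree). [cite: DavisRabinowitz1984, Sect. 2.10.8 (2.10.8.3)] -/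
noncomputable def lanczosLambda (f : ℝ → ℝ) (q : ℕ) : ℝ :=
  iteratedDeriv (q - 1) f 1 - iteratedDeriv (q - 1) f 0

/-- The polynomial part `h_{p-1}(x) = Σ_{q=1}^{p-1} λ_q B_q(x)/q!` **(2.10.8.3)**.
[cite: DavisRabinowitz1984, Sect. 2.10.8 (2.10.8.3)] -/
noncomputable def lanczosPoly (f : ℝ → ℝ) (p : ℕ) (x : ℝ) : ℝ :=
  ∑ q ∈ Ico 1 p, lanczosLambda f q * bernoulliFun q x / (q.factorial : ℝ)

/-- The remainder `g_p = f - h_{p-1}` **(2.10.8.4)**. [cite: DavisRabinowitz1984, Sect. 2.10.8 (2.10.8.4)] -/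
noncomputable def lanczosRemainder (f : ℝ → ℝ) (p : ℕ) (x : ℝ) : ℝ :=
  f x - lanczosPoly f p x

/-- `C_r g`: `C_0 g = ∫_0^1 g` and `C_r g = 2 ∫_0^1 g(x) cos 2πrx dx` for `r ≥ 1` **(2.10.8.1)–(2.10.8.2)**.
[cite: DavisRabinowitz1984, Sect. 2.10.8 (2.10.8.1)-(2.10.8.2)] -/
noncomputable def unitCosCoeff (g : ℝ → ℝ) (r : ℕ) : ℝ :=
  if r = 0 then ∫ x in (0 : ℝ)..1, g x else 2 * ∫ x in (0 : ℝ)..1, g x * Real.cos (2 * Real.pi * r * x)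

/-- `S_r g`: `S_0 g = 0` and `S_r g = 2 ∫_0^1 g(x) sin 2πrx dx` for `r ≥ 1` **(2.10.8.1)–(2.10.8.2)**.
[cite: DavisRabinowitz1984, Sect. 2.10.8 (2.10.8.1)-(2.10.8.2)] -/
noncomputable def unitSinCoeff (g : ℝ → ℝ) (r : ℕ) : ℝ :=
  if r = 0 then 0 else 2 * ∫ x in (0 : ℝ)..1, g x * Real.sin (2 * Real.pi * r * x)

/-- `S_0 g = 0` **(2.10.8.2)**. [cite: DavisRabinowitz1984, Sect. 2.10.8 (2.10.8.2)] -/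
@[simp]
theorem unitSinCoeff_zero (g : ℝ → ℝ) : unitSinCoeff g 0 = 0 := by
  simp [unitSinCoeff]

/-- `C_0 g = I g` **(2.10.8.2)**. [cite: DavisRabinowitz1984, Sect. 2.10.8 (2.10.8.2)] -/
@[simp]
theorem unitCosCoeff_zero (g : ℝ → ℝ) : unitCosCoeff g 0 = ∫ x in (0 : ℝ)..1, g x := by
  simp [unitCosCoeff]

/-! ## `I h_{p-1} = 0`, hence `I g_p = I f` -/

/-- Each term of `h_{p-1}` integrates to zero over `[0, 1]` (`∫_0^1 B_q = 0` for `q ≥ 1`).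
[cite: DavisRabinowitz1984, Sect. 2.10.8 (2.10.8.3)] -/
theorem integral_lanczosPoly_term (f : ℝ → ℝ) {q : ℕ} (hq : q ≠ 0) :
    ∫ x in (0 : ℝ)..1, lanczosLambda f q * bernoulliFun q x / (q.factorial : ℝ) = 0 := by
  rw [intervalIntegral.integral_div, intervalIntegral.integral_const_mul,
    integral_bernoulliFun_eq_zero hq, mul_zero, zero_div]

/-- "Note that since `I h_{p-1} = 0` …": the polynomial part has zero integral over `[0, 1]`.
[cite: DavisRabinowitz1984, Sect. 2.10.8 (2.10.8.3)-(2.10.8.4)] -/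
theorem integral_lanczosPoly (f : ℝ → ℝ) (p : ℕ) : ∫ x in (0 : ℝ)..1, lanczosPoly f p x = 0 := by
  unfold lanczosPoly
  rw [intervalIntegral.integral_finsetSum]
  · refine Finset.sum_eq_zero fun q hq => ?_
    have hq1 : q ≠ 0 := by
      have := (Finset.mem_Ico.mp hq).1
      omega
    exact integral_lanczosPoly_term f hq1
  · intro q _
    exact ((continuous_const.mul (continuous_bernoulliFun q)).div_const _).intervalIntegrable _ _

/-- "… `I g_p = I f`": the remainder has the same integral as `f` (for `f` integrable on `[0, 1]`).
[cite: DavisRabinowitz1984, Sect. 2.10.8 (2.10.8.4)] -/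
theorem integral_lanczosRemainder {f : ℝ → ℝ} (hf : IntervalIntegrable f volume 0 1) (p : ℕ) :
    ∫ x in (0 : ℝ)..1, lanczosRemainder f p x = ∫ x in (0 : ℝ)..1, f x := by
  unfold lanczosRemainder
  have hh : IntervalIntegrable (lanczosPoly f p) volume 0 1 := by
    refine Continuous.intervalIntegrable ?_ _ _
    unfold lanczosPoly
    exact continuous_finsetSum _ fun q _ =>
      (continuous_const.mul (continuous_bernoulliFun q)).div_const _
  rw [intervalIntegral.integral_sub hf hh, integral_lanczosPoly, sub_zero]

/-- Consequently `C_0 g_p = C_0 f`. [cite: DavisRabinowitz1984, Sect. 2.10.8 (2.10.8.2), (2.10.8.4)] -/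
theorem unitCosCoeff_zero_lanczosRemainder {f : ℝ → ℝ} (hf : IntervalIntegrable f volume 0 1) (p : ℕ) :
    unitCosCoeff (lanczosRemainder f p) 0 = unitCosCoeff f 0 := by
  simp [integral_lanczosRemainder hf p]

/-! ## The integrals `J_q(γ)` -/

/-- `J_q(γ) = ∫_0^1 e^{-γ x} (B_q(x)/q!) dx` for complex `γ`. [cite: DavisRabinowitz1984, Sect. 2.10.8 (2.10.8.7)] -/
noncomputable def lanczosJ (q : ℕ) (γ : ℂ) : ℂ :=
  ∫ x in (0 : ℝ)..1, Complex.exp (-(γ * x)) * (bernoulliFun q x : ℂ) / (q.factorial : ℂ)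

/-- `J_q(0) = (∫_0^1 B_q)/q!`. [cite: DavisRabinowitz1984, Sect. 2.10.8 (2.10.8.7)] -/
theorem lanczosJ_zero (q : ℕ) :
    lanczosJ q 0 = ((∫ x in (0 : ℝ)..1, bernoulliFun q x : ℝ) : ℂ) / (q.factorial : ℂ) := by
  unfold lanczosJ
  rw [intervalIntegral.integral_div]
  congr 1
  rw [← intervalIntegral.integral_ofReal]
  refine intervalIntegral.integral_congr fun x _ => ?_
  simp

/-- `J_0(0) = 1`. [cite: DavisRabinowitz1984, Sect. 2.10.8 (2.10.8.7)] -/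
theorem lanczosJ_zero_zero : lanczosJ 0 0 = 1 := by
  rw [lanczosJ_zero, integral_bernoulliFun]
  simp

/-- `J_q(0) = 0` for `q ≥ 1`. [cite: DavisRabinowitz1984, Sect. 2.10.8 (2.10.8.7)] -/
theorem lanczosJ_zero_of_ne_zero {q : ℕ} (hq : q ≠ 0) : lanczosJ q 0 = 0 := by
  rw [lanczosJ_zero, integral_bernoulliFun_eq_zero hq]
  simp

/-- The Fourier case of (2.10.8.7): for `γ = 2π i n`, `n ≠ 0` an integer, `J_q(γ) = -γ^{-q}` (`q ≥ 1`) — these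
are the Fourier coefficients of the Bernoulli polynomials (Mathlib `bernoulliFourierCoeff_eq`).
[cite: DavisRabinowitz1984, Sect. 2.10.8 (2.10.8.7)] -/
theorem lanczosJ_two_pi_I_mul {q : ℕ} (hq : q ≠ 0) {n : ℤ} (hn : n ≠ 0) :
    lanczosJ q (2 * Real.pi * I * n) = -1 / (2 * Real.pi * I * n) ^ q := by
  have h := bernoulliFourierCoeff_eq hq n
  rw [bernoulliFourierCoeff, fourierCoeffOn_eq_integral] at h
  simp_rw [fourier_coe_apply, smul_eq_mul] at h
  have hI : ∫ x in (0 : ℝ)..1, Complex.exp (-(2 * Real.pi * I * n * x)) * (bernoulliFun q x : ℂ)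
      = -(q.factorial : ℂ) / (2 * Real.pi * I * n) ^ q := by
    rw [← h]
    simp only [sub_zero, Complex.ofReal_one, div_one, one_smul, Int.cast_neg]
    refine intervalIntegral.integral_congr fun x _ => ?_
    congr 1
    congr 1
    ring
  unfold lanczosJ
  rw [intervalIntegral.integral_div, hI]
  have hf : (q.factorial : ℂ) ≠ 0 := by exact_mod_cast Nat.factorial_ne_zero q
  field_simp

/-- The case `q = 1` of (2.10.8.7) for every `γ ≠ 0`, by one integration by parts (an explicit
antiderivative of `e^{-γx}(x - ½)`): `J_1(γ) = (1 - e^{-γ})/γ² - (1 + e^{-γ})/(2γ)`.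
[cite: DavisRabinowitz1984, Sect. 2.10.8 (2.10.8.7)] -/
theorem lanczosJ_one {γ : ℂ} (hγ : γ ≠ 0) :
    lanczosJ 1 γ = (1 - Complex.exp (-γ)) / γ ^ 2 - (1 + Complex.exp (-γ)) / (2 * γ) := by
  have hF : ∀ x : ℝ, HasDerivAt
      (fun y : ℝ => -Complex.exp (-(γ * (y : ℂ))) * ((((y : ℂ)) - 1 / 2) / γ + 1 / γ ^ 2))
      (Complex.exp (-(γ * (x : ℂ))) * ((x : ℂ) - 1 / 2)) x := by
    intro x
    have he : HasDerivAt (fun z : ℂ => Complex.exp (-(γ * z))) (Complex.exp (-(γ * (x : ℂ))) * -(γ * 1))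
        (x : ℂ) := (((hasDerivAt_id' (x : ℂ)).const_mul γ).neg).cexp
    have hl : HasDerivAt (fun z : ℂ => (z - 1 / 2) / γ + 1 / γ ^ 2) (1 / γ) (x : ℂ) :=
      (((hasDerivAt_id' (x : ℂ)).sub_const (1 / 2)).div_const γ).add_const (1 / γ ^ 2)
    have h1 := (he.neg.mul hl).comp_ofReal
    refine h1.congr_deriv ?_
    simp only [Pi.neg_apply, mul_one]
    field_simp
    ring
  have hfun : ∀ x : ℝ, Complex.exp (-(γ * (x : ℂ))) * (bernoulliFun 1 x : ℂ) / ((1 : ℕ).factorial : ℂ)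
      = Complex.exp (-(γ * (x : ℂ))) * ((x : ℂ) - 1 / 2) := by
    intro x
    rw [bernoulliFun_one]
    push_cast
    ring
  have hint : IntervalIntegrable (fun x : ℝ => Complex.exp (-(γ * (x : ℂ))) * ((x : ℂ) - 1 / 2)) volume 0 1 :=
    ((Complex.continuous_exp.comp ((continuous_const.mul Complex.continuous_ofReal).neg)).mul
      (Complex.continuous_ofReal.sub continuous_const)).intervalIntegrable _ _
  unfold lanczosJ
  simp_rw [hfun]
  rw [intervalIntegral.integral_eq_sub_of_hasDerivAt (fun x _ => hF x) hint]
  simp only [Complex.ofReal_one, Complex.ofReal_zero, mul_one, mul_zero, neg_zero, Complex.exp_zero]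
  field_simp
  ring

/-- The printed right-hand side of **(2.10.8.7)**:
`(1 - e^{-γ}) Σ_{l=0, l even}^{q} (B_l/l!) γ^{l-q-1} - (γ^{-q}/2)(e^{-γ} + 1)`.
[cite: DavisRabinowitz1984, Sect. 2.10.8 (2.10.8.7)] -/
noncomputable def lanczosJRHS (q : ℕ) (γ : ℂ) : ℂ :=
  (1 - Complex.exp (-γ)) * ∑ l ∈ (range (q + 1)).filter Even,
      (bernoulli l : ℂ) / (l.factorial : ℂ) * γ ^ ((l : ℤ) - q - 1) -
    γ ^ (-(q : ℤ)) / 2 * (Complex.exp (-γ) + 1)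

/-- **(2.10.8.7)** as a NAMED FACT: for `q ≥ 1` and `γ ≠ 0`, `J_q(γ)` equals the printed closed form (proved in
the text's sources by repeated integration by parts; proved here at `γ = 2π i n` and for `q = 1` below, and in
general at the end of the file: `LanczosJFormula_holds`).
[cite: DavisRabinowitz1984, Sect. 2.10.8 (2.10.8.7)] -/
def LanczosJFormula (q : ℕ) (γ : ℂ) : Prop :=
  q ≠ 0 → γ ≠ 0 → lanczosJ q γ = lanczosJRHS q γ

/-- At `γ = 2π i n` (`n ≠ 0`) the factor `1 - e^{-γ}` vanishes and the printed right-hand side of (2.10.8.7)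
reduces to `-γ^{-q}`. [cite: DavisRabinowitz1984, Sect. 2.10.8 (2.10.8.7)] -/
theorem lanczosJRHS_two_pi_I_mul (q : ℕ) (n : ℤ) :
    lanczosJRHS q (2 * Real.pi * I * n) = -1 / (2 * Real.pi * I * n) ^ q := by
  unfold lanczosJRHS
  have hexp : Complex.exp (-(2 * Real.pi * I * n)) = 1 := by
    have := Complex.exp_int_mul_two_pi_mul_I (-n)
    rw [← this]
    congr 1
    push_cast
    ring
  rw [hexp, sub_self, zero_mul, zero_sub, zpow_neg, zpow_natCast]
  ring

/-- Hence (2.10.8.7) HOLDS at the Fourier points `γ = 2π i n`, `n ≠ 0` — the case used for the Fourier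
coefficients of `f̂`. [cite: DavisRabinowitz1984, Sect. 2.10.8 (2.10.8.7)] -/
theorem lanczosJFormula_two_pi_I_mul (q : ℕ) {n : ℤ} (hn : n ≠ 0) :
    LanczosJFormula q (2 * Real.pi * I * n) := by
  intro hq _
  rw [lanczosJ_two_pi_I_mul hq hn, lanczosJRHS_two_pi_I_mul]

/-- … and (2.10.8.7) HOLDS for `q = 1` and every `γ ≠ 0` (the even-`l` sum is the single term `l = 0`).
[cite: DavisRabinowitz1984, Sect. 2.10.8 (2.10.8.7)] -/
theorem lanczosJFormula_one (γ : ℂ) : LanczosJFormula 1 γ := by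
  intro _ hγ
  rw [lanczosJ_one hγ]
  unfold lanczosJRHS
  have hs : (range (1 + 1)).filter Even = {0} := by decide
  rw [hs, Finset.sum_singleton]
  simp only [bernoulli_zero, Rat.cast_one, Nat.factorial_zero, Nat.cast_one, div_one, one_mul,
    Nat.cast_zero, zero_sub]
  rw [show (-1 - 1 : ℤ) = -2 by norm_num, zpow_neg, zpow_neg, zpow_one, zpow_two]
  field_simp
  ring

/-- **(2.10.8.8)** as a NAMED FACT: for `0 < |γ| < 2π`,
`J_q(γ) = -(1 - e^{-γ}) Σ_{l ≥ q+1} (B_l/l!) γ^{l-q-1}` (the series converges since `|γ| < 2π`; re-indexed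
`l ↦ l + q + 1`; for `l ≥ 2` Mathlib's `bernoulli` agrees with the text's `B_l = B_l(1)`); proved at the end
of the file (`LanczosJSmallGamma_holds`). [cite: DavisRabinowitz1984, Sect. 2.10.8 (2.10.8.8)] -/
def LanczosJSmallGamma (q : ℕ) (γ : ℂ) : Prop :=
  q ≠ 0 → γ ≠ 0 → ‖γ‖ < 2 * Real.pi →
    ∃ s : ℂ, HasSum (fun l : ℕ => (bernoulli (l + (q + 1)) : ℂ) / ((l + (q + 1)).factorial : ℂ) * γ ^ l) s ∧
      lanczosJ q γ = -(1 - Complex.exp (-γ)) * s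

/-- Lyness's decay statement as a NAMED FACT: for `f` smooth, the Fourier coefficients of the remainder `g_p`
are `O(r^{-p})`; proved at the end of the file (`LanczosRemainderDecay_holds`).
[cite: DavisRabinowitz1984, Sect. 2.10.8 (2.10.8.4)] -/
def LanczosRemainderDecay (f : ℝ → ℝ) (p : ℕ) : Prop :=
  ContDiff ℝ ⊤ f → 2 ≤ p →
    ∃ C : ℝ, ∀ r : ℕ, 1 ≤ r →
      |unitCosCoeff (lanczosRemainder f p) r| ≤ C / (r : ℝ) ^ p ∧
        |unitSinCoeff (lanczosRemainder f p) r| ≤ C / (r : ℝ) ^ p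

/-! ## Small cases of the data -/

/-- `h_0 = h_1 = 0` (empty sums: `p ≤ 1`), so `g_1 = f`. [cite: DavisRabinowitz1984, Sect. 2.10.8 (2.10.8.3)] -/
theorem lanczosPoly_of_le_one (f : ℝ → ℝ) {p : ℕ} (hp : p ≤ 1) (x : ℝ) : lanczosPoly f p x = 0 := by
  unfold lanczosPoly
  rw [Finset.Ico_eq_empty_of_le hp, Finset.sum_empty]

/-- `h_1(x)` for `p = 2`: `λ_1 B_1(x) = (f(1) - f(0))(x - ½)` — subtracting it makes the remainder `g_2`
take equal values at the two endpoints. [cite: DavisRabinowitz1984, Sect. 2.10.8 (2.10.8.3)] -/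
theorem lanczosPoly_two (f : ℝ → ℝ) (x : ℝ) : lanczosPoly f 2 x = (f 1 - f 0) * (x - 1 / 2) := by
  unfold lanczosPoly lanczosLambda
  have : Finset.Ico 1 2 = {1} := by decide
  rw [this, Finset.sum_singleton]
  simp [bernoulliFun_one]

/-- The point of the construction at `p = 2`: `g_2(0) = g_2(1)` (the periodic extension of `g_2` is
continuous, so its Fourier coefficients decay faster than those of `f`).
[cite: DavisRabinowitz1984, Sect. 2.10.8 (2.10.8.4)] -/
theorem lanczosRemainder_two_endpoints (f : ℝ → ℝ) :
    lanczosRemainder f 2 0 = lanczosRemainder f 2 1 := by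
  unfold lanczosRemainder
  rw [lanczosPoly_two, lanczosPoly_two]
  ring

end Literature.Analysis.Quadrature

/-! ## Proof of (2.10.8.7) for every `q ≥ 1`, `γ ≠ 0` (`LanczosJFormula_holds`)

"Repeated integration by parts": with `u = B_{q+1}(x)/(q+1)!`, `dv = e^{-γx} dx`, Mathlib's
`B_{q+1}' = (q+1) B_q` (`hasDerivAt_bernoulliFun`) and `B_{q+1}(1) = B_{q+1}(0) = B_{q+1}` (`q ≥ 1`),
`J_{q+1}(γ) = ((B_{q+1}/(q+1)!)(1 - e^{-γ}) + J_q(γ))/γ` (`lanczosJ_succ`); the printed right-hand side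
obeys the same recurrence (`lanczosJRHS_succ`; for odd `q + 1 ≥ 3` the even-`l` sum gains no term and
`B_{q+1} = 0`), and the case `q = 1` is `lanczosJFormula_one` above.
-/

namespace Literature.Analysis.Quadrature

section LanczosJFormulaProof

/-- One integration by parts: for `q ≥ 1` and `γ ≠ 0`,
`J_{q+1}(γ) = ( (B_{q+1}/(q+1)!) (1 - e^{-γ}) + J_q(γ) ) / γ`
(`u = B_{q+1}(x)/(q+1)!`, `dv = e^{-γx} dx`; `B_{q+1}' = (q+1) B_q`, `B_{q+1}(1) = B_{q+1}(0) = B_{q+1}`).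
[cite: DavisRabinowitz1984, Sect. 2.10.8 (2.10.8.7)] -/
theorem lanczosJ_succ {q : ℕ} (hq : 1 ≤ q) {γ : ℂ} (hγ : γ ≠ 0) :
    lanczosJ (q + 1) γ =
      ((bernoulli (q + 1) : ℂ) / ((q + 1).factorial : ℂ) * (1 - Complex.exp (-γ)) + lanczosJ q γ) / γ := by
  -- `u`, `u'`, `v`, `v'`
  have hu : ∀ x ∈ Set.uIcc (0 : ℝ) 1, HasDerivAt (fun y : ℝ => ((bernoulliFun (q + 1) y : ℝ) : ℂ))
      ((((q + 1 : ℕ) : ℝ) * bernoulliFun q x : ℝ) : ℂ) x := by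
    intro x _
    have h := (hasDerivAt_bernoulliFun (q + 1) x).ofReal_comp
    simpa only [Nat.add_sub_cancel] using h
  have hv : ∀ x ∈ Set.uIcc (0 : ℝ) 1, HasDerivAt (fun y : ℝ => -Complex.exp (-(γ * (y : ℂ))) / γ)
      (Complex.exp (-(γ * (x : ℂ)))) x := by
    intro x _
    have he : HasDerivAt (fun z : ℂ => Complex.exp (-(γ * z))) (Complex.exp (-(γ * (x : ℂ))) * -(γ * 1))
        (x : ℂ) := (((hasDerivAt_id' (x : ℂ)).const_mul γ).neg).cexp
    have h1 := ((he.neg).div_const γ).comp_ofReal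
    refine h1.congr_deriv ?_
    field_simp
  have hu' : IntervalIntegrable (fun x : ℝ => ((((q + 1 : ℕ) : ℝ) * bernoulliFun q x : ℝ) : ℂ))
      volume 0 1 :=
    (Complex.continuous_ofReal.comp (continuous_const.mul (continuous_bernoulliFun q))).intervalIntegrable
      _ _
  have hv' : IntervalIntegrable (fun x : ℝ => Complex.exp (-(γ * (x : ℂ)))) volume 0 1 :=
    (Complex.continuous_exp.comp ((continuous_const.mul Complex.continuous_ofReal).neg)).intervalIntegrable
      _ _
  have hparts := intervalIntegral.integral_mul_deriv_eq_deriv_mul hu hv hu' hv'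
  -- the two integrals in terms of `J_{q+1}` and `J_q`
  have hJ1 : lanczosJ (q + 1) γ = (∫ x in (0 : ℝ)..1,
      ((bernoulliFun (q + 1) x : ℝ) : ℂ) * Complex.exp (-(γ * (x : ℂ)))) / ((q + 1).factorial : ℂ) := by
    unfold lanczosJ
    rw [intervalIntegral.integral_div]
    congr 1
    refine intervalIntegral.integral_congr fun x _ => ?_
    simp only [mul_comm]
  have hJ0 : ∫ x in (0 : ℝ)..1, ((((q + 1 : ℕ) : ℝ) * bernoulliFun q x : ℝ) : ℂ) *
      (-Complex.exp (-(γ * (x : ℂ))) / γ) =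
      -(((q + 1 : ℕ) : ℂ) * (q.factorial : ℂ) / γ) * lanczosJ q γ := by
    unfold lanczosJ
    rw [← intervalIntegral.integral_const_mul]
    refine intervalIntegral.integral_congr fun x _ => ?_
    have hf : (q.factorial : ℂ) ≠ 0 := by exact_mod_cast Nat.factorial_ne_zero q
    push_cast
    field_simp
  -- endpoint values
  have hq1 : q + 1 ≠ 1 := by omega
  have hB1 : bernoulliFun (q + 1) 1 = bernoulli (q + 1) := by
    rw [bernoulliFun_endpoints_eq_of_ne_one hq1, bernoulliFun_eval_zero]
  have hB0 : bernoulliFun (q + 1) 0 = bernoulli (q + 1) := bernoulliFun_eval_zero _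
  rw [hJ1, hparts, hJ0, hB1, hB0]
  have hf : ((q + 1).factorial : ℂ) = ((q + 1 : ℕ) : ℂ) * (q.factorial : ℂ) := by
    rw [Nat.factorial_succ]; push_cast; ring
  have hf0 : (q.factorial : ℂ) ≠ 0 := by exact_mod_cast Nat.factorial_ne_zero q
  have hq0 : ((q + 1 : ℕ) : ℂ) ≠ 0 := by exact_mod_cast Nat.succ_ne_zero q
  rw [hf]
  simp only [Complex.ofReal_one, Complex.ofReal_zero, mul_one, mul_zero, neg_zero, Complex.exp_zero]
  push_cast
  field_simp
  ring

/-- The printed right-hand side of (2.10.8.7) obeys the same recurrence: for `q ≥ 1` and `γ ≠ 0`,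
`R_{q+1}(γ) = ( (B_{q+1}/(q+1)!) (1 - e^{-γ}) + R_q(γ) ) / γ` (for odd `q + 1 ≥ 3` the new term is
absent from the even-`l` sum, and `B_{q+1} = 0`). [cite: DavisRabinowitz1984, Sect. 2.10.8 (2.10.8.7)] -/
theorem lanczosJRHS_succ {q : ℕ} (hq : 1 ≤ q) {γ : ℂ} (hγ : γ ≠ 0) :
    lanczosJRHS (q + 1) γ =
      ((bernoulli (q + 1) : ℂ) / ((q + 1).factorial : ℂ) * (1 - Complex.exp (-γ)) + lanczosJRHS q γ) /
        γ := by
  unfold lanczosJRHS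
  -- shift of the exponents
  have hshift : ∀ l : ℕ, γ ^ ((l : ℤ) - ((q + 1 : ℕ) : ℤ) - 1) = γ ^ ((l : ℤ) - q - 1) * γ⁻¹ := by
    intro l
    rw [← zpow_sub_one₀ hγ]
    congr 1
    push_cast
    ring
  have hsum : ∑ l ∈ (range (q + 1)).filter Even,
      (bernoulli l : ℂ) / (l.factorial : ℂ) * γ ^ ((l : ℤ) - ((q + 1 : ℕ) : ℤ) - 1) =
      (∑ l ∈ (range (q + 1)).filter Even, (bernoulli l : ℂ) / (l.factorial : ℂ) * γ ^ ((l : ℤ) - q - 1)) *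
        γ⁻¹ := by
    rw [Finset.sum_mul]
    exact Finset.sum_congr rfl fun l _ => by rw [hshift, mul_assoc]
  have hpow : γ ^ (-((q + 1 : ℕ) : ℤ)) = γ ^ (-(q : ℤ)) * γ⁻¹ := by
    rw [← zpow_sub_one₀ hγ]
    congr 1
    push_cast
    ring
  rw [Finset.range_add_one, Finset.filter_insert]
  by_cases he : Even (q + 1)
  · rw [if_pos he, Finset.sum_insert (by simp), hsum, hpow]
    have hl : γ ^ (((q + 1 : ℕ) : ℤ) - ((q + 1 : ℕ) : ℤ) - 1) = γ⁻¹ := by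
      rw [sub_self, zero_sub, zpow_neg_one]
    rw [hl]
    field_simp
    ring
  · rw [if_neg he, hsum, hpow]
    have hodd : Odd (q + 1) := Nat.not_even_iff_odd.1 he
    have hB : bernoulli (q + 1) = 0 := by
      rw [bernoulli_eq_bernoulli'_of_ne_one (by omega)]
      exact bernoulli'_eq_zero_of_odd hodd (by omega)
    rw [hB]
    push_cast
    field_simp
    ring

/-- **(2.10.8.7) for every `q ≥ 1` and `γ ≠ 0`**:
`J_q(γ) = (1 - e^{-γ}) Σ_{l=0, l even}^{q} (B_l/l!) γ^{l-q-1} - (γ^{-q}/2)(e^{-γ} + 1)`, by induction on `q`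
from the case `q = 1` (`lanczosJFormula_one`) through the integration-by-parts recurrence
`lanczosJ_succ` / `lanczosJRHS_succ` ("repeated integration by parts"). Discharge of the named fact
`LanczosJFormula`. [cite: DavisRabinowitz1984, Sect. 2.10.8 (2.10.8.7)] -/
theorem LanczosJFormula_holds : ∀ (q : ℕ) (γ : ℂ), LanczosJFormula q γ := by
  intro q γ hq hγ
  have hq1 : 1 ≤ q := Nat.one_le_iff_ne_zero.2 hq
  induction q, hq1 using Nat.le_induction with
  | base => exact lanczosJFormula_one γ one_ne_zero hγ
  | succ q hq1 ih =>
    rw [lanczosJ_succ hq1 hγ, ih (by omega), lanczosJRHS_succ hq1 hγ]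

end LanczosJFormulaProof

/-! ## Proof of Lyness's decay statement (`LanczosRemainderDecay_holds`)

For `f` smooth, `g_p = f - h_{p-1}` has `g_p^{(j)}(1) = g_p^{(j)}(0)` for `j ≤ p - 2`: indeed
`B_q^{(j)} = q(q-1)⋯(q-j+1) B_{q-j}` and `B_m(1) - B_m(0) = [m = 1]`, so
`h_{p-1}^{(j)}(1) - h_{p-1}^{(j)}(0) = λ_{j+1} = f^{(j)}(1) - f^{(j)}(0)`
(`iteratedDeriv_lanczosPoly_one_sub_zero`). Integrating by parts on `[0, 1]` (`sin 2πr = 0`, `cos 2πr = 1`)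
moves one derivative onto the function at the cost of a factor `(2πr)⁻¹`, with no boundary term as long as
the endpoint values agree (`fourier_unit_decay`, induction on the number of such steps); after `p - 1` free
steps one more integration by parts bounds the coefficients of `g_p` by `K/(2πr)^p`.
-/

open Set Filter Topology
open scoped ContDiff

section LanczosRemainderDecayProof

/-- One integration by parts for the cosine coefficient on `[0, 1]` (`sin 2πr = 0`):
`∫_0^1 φ cos(2πrx) = -(2πr)⁻¹ ∫_0^1 φ' sin(2πrx)`. [folklore] -/
private theorem integral_mul_cos_eq_ibp {φ : ℝ → ℝ} (hφ : ContDiff ℝ ∞ φ) {r : ℕ} (hr : 1 ≤ r) :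
    ∫ x in (0 : ℝ)..1, φ x * Real.cos (2 * Real.pi * r * x) =
      -(∫ x in (0 : ℝ)..1, deriv φ x * Real.sin (2 * Real.pi * r * x)) / (2 * Real.pi * r) := by
  set w : ℝ := 2 * Real.pi * r with hw
  have hrpos : (0 : ℝ) < r := by exact_mod_cast hr
  have hwpos : 0 < w := by rw [hw]; positivity
  have hw0 : w ≠ 0 := hwpos.ne'
  have hdiff : Differentiable ℝ φ := (contDiff_infty_iff_deriv.mp hφ).1
  have hφ' : Continuous (deriv φ) := hφ.continuous_deriv (by simp)
  have hv : ∀ x : ℝ, HasDerivAt (fun x : ℝ => Real.sin (w * x) / w) (Real.cos (w * x)) x := by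
    intro x
    have h := ((Real.hasDerivAt_sin (w * x)).comp x ((hasDerivAt_id x).const_mul w)).div_const w
    refine h.congr_deriv ?_
    simp only [mul_one]
    field_simp
  have hibp := intervalIntegral.integral_mul_deriv_eq_deriv_mul (a := (0 : ℝ)) (b := 1)
    (u := φ) (u' := deriv φ) (fun x _ => (hdiff x).hasDerivAt) (fun x _ => hv x)
    (hφ'.intervalIntegrable _ _) ((by fun_prop : Continuous fun x : ℝ => Real.cos (w * x)).intervalIntegrable _ _)
  rw [hibp]
  have hsin1 : Real.sin (w * 1) = 0 := by
    rw [mul_one, hw, show 2 * Real.pi * (r : ℝ) = ((2 * r : ℕ) : ℝ) * Real.pi by push_cast; ring]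
    exact Real.sin_nat_mul_pi (2 * r)
  simp only [hsin1, mul_zero, Real.sin_zero, zero_div, sub_zero]
  rw [show (fun x : ℝ => deriv φ x * (Real.sin (w * x) / w)) =
      fun x : ℝ => deriv φ x * Real.sin (w * x) / w from funext fun x => by ring,
    intervalIntegral.integral_div]
  ring

/-- One integration by parts for the sine coefficient on `[0, 1]` (`cos 2πr = 1`):
`∫_0^1 φ sin(2πrx) = (-(φ 1 - φ 0) + ∫_0^1 φ' cos(2πrx))/(2πr)`. [folklore] -/
private theorem integral_mul_sin_eq_ibp {φ : ℝ → ℝ} (hφ : ContDiff ℝ ∞ φ) {r : ℕ} (hr : 1 ≤ r) :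
    ∫ x in (0 : ℝ)..1, φ x * Real.sin (2 * Real.pi * r * x) =
      (-(φ 1 - φ 0) + ∫ x in (0 : ℝ)..1, deriv φ x * Real.cos (2 * Real.pi * r * x)) / (2 * Real.pi * r) := by
  set w : ℝ := 2 * Real.pi * r with hw
  have hrpos : (0 : ℝ) < r := by exact_mod_cast hr
  have hwpos : 0 < w := by rw [hw]; positivity
  have hw0 : w ≠ 0 := hwpos.ne'
  have hdiff : Differentiable ℝ φ := (contDiff_infty_iff_deriv.mp hφ).1
  have hφ' : Continuous (deriv φ) := hφ.continuous_deriv (by simp)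
  have hv : ∀ x : ℝ, HasDerivAt (fun x : ℝ => -Real.cos (w * x) / w) (Real.sin (w * x)) x := by
    intro x
    have h := ((Real.hasDerivAt_cos (w * x)).comp x ((hasDerivAt_id x).const_mul w)).neg.div_const w
    refine h.congr_deriv ?_
    simp only [mul_one]
    field_simp
  have hibp := intervalIntegral.integral_mul_deriv_eq_deriv_mul (a := (0 : ℝ)) (b := 1)
    (u := φ) (u' := deriv φ) (fun x _ => (hdiff x).hasDerivAt) (fun x _ => hv x)
    (hφ'.intervalIntegrable _ _) ((by fun_prop : Continuous fun x : ℝ => Real.sin (w * x)).intervalIntegrable _ _)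
  rw [hibp]
  have hcos1 : Real.cos (w * 1) = 1 := by
    rw [mul_one, hw, show 2 * Real.pi * (r : ℝ) = (r : ℕ) * (2 * Real.pi) by ring]
    exact Real.cos_nat_mul_two_pi r
  simp only [hcos1, mul_zero, Real.cos_zero]
  rw [show (fun x : ℝ => deriv φ x * (-Real.cos (w * x) / w)) =
      fun x : ℝ => -(deriv φ x * Real.cos (w * x) / w) from funext fun x => by ring,
    intervalIntegral.integral_neg, intervalIntegral.integral_div]
  field_simp
  ring

/-- **Decay by repeated integration by parts.** If `φ` is smooth and `φ^{(j)}(1) = φ^{(j)}(0)` for all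
`j < m`, then `|∫_0^1 φ cos(2πrx)|, |∫_0^1 φ sin(2πrx)| ≤ K/(2πr)^{m+1}` for all `r ≥ 1`, with `K`
independent of `r`. [folklore] -/
private theorem fourier_unit_decay (m : ℕ) : ∀ φ : ℝ → ℝ, ContDiff ℝ ∞ φ →
    (∀ j < m, iteratedDeriv j φ 1 = iteratedDeriv j φ 0) →
    ∃ K : ℝ, ∀ r : ℕ, 1 ≤ r →
      |∫ x in (0 : ℝ)..1, φ x * Real.cos (2 * Real.pi * r * x)| ≤ K / (2 * Real.pi * r) ^ (m + 1) ∧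
      |∫ x in (0 : ℝ)..1, φ x * Real.sin (2 * Real.pi * r * x)| ≤ K / (2 * Real.pi * r) ^ (m + 1) := by
  induction m with
  | zero =>
    intro φ hφ _
    have hφ' : Continuous (deriv φ) := hφ.continuous_deriv (by simp)
    -- a bound for `|φ'|` on `[0, 1]`
    obtain ⟨M, hM⟩ := isCompact_Icc.exists_bound_of_continuousOn (hφ'.continuousOn (s := Icc (0 : ℝ) 1))
    have hM0 : 0 ≤ M := (norm_nonneg _).trans (hM 0 (by simp))
    have hbd : ∀ (g : ℝ → ℝ), (∀ x, |g x| ≤ 1) →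
        |∫ x in (0 : ℝ)..1, deriv φ x * g x| ≤ M := by
      intro g hg
      have h := intervalIntegral.norm_integral_le_of_norm_le_const (a := (0 : ℝ)) (b := 1) (C := M)
        (f := fun x => deriv φ x * g x) (fun x hx => by
          rw [norm_mul, Real.norm_eq_abs (g x)]
          have hx' : x ∈ Icc (0 : ℝ) 1 := by
            rw [uIoc_of_le zero_le_one] at hx
            exact ⟨hx.1.le, hx.2⟩
          calc ‖deriv φ x‖ * |g x| ≤ M * 1 := mul_le_mul (hM x hx') (hg x) (abs_nonneg _) hM0
            _ = M := mul_one M)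
      simpa using h
    refine ⟨|φ 1 - φ 0| + M, fun r hr => ?_⟩
    have hw : (0 : ℝ) < 2 * Real.pi * r := by
      have : (0 : ℝ) < r := by exact_mod_cast hr
      positivity
    simp only [zero_add, pow_one]
    constructor
    · rw [integral_mul_cos_eq_ibp hφ hr, abs_div, abs_neg, abs_of_pos hw, div_le_div_iff_of_pos_right hw]
      exact (hbd _ fun x => Real.abs_sin_le_one _).trans (by linarith [abs_nonneg (φ 1 - φ 0)])
    · rw [integral_mul_sin_eq_ibp hφ hr, abs_div, abs_of_pos hw, div_le_div_iff_of_pos_right hw]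
      refine (abs_add_le _ _).trans ?_
      rw [abs_neg]
      exact add_le_add le_rfl (hbd _ fun x => Real.abs_cos_le_one _)
  | succ m ih =>
    intro φ hφ hmatch
    have hφd : ContDiff ℝ ∞ (deriv φ) := (contDiff_infty_iff_deriv.mp hφ).2
    have h0 : φ 1 = φ 0 := by simpa using hmatch 0 (Nat.succ_pos m)
    have hmatch' : ∀ j < m, iteratedDeriv j (deriv φ) 1 = iteratedDeriv j (deriv φ) 0 := by
      intro j hj
      rw [← iteratedDeriv_succ']
      exact hmatch (j + 1) (by omega)
    obtain ⟨K, hK⟩ := ih (deriv φ) hφd hmatch'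
    refine ⟨K, fun r hr => ?_⟩
    have hw : (0 : ℝ) < 2 * Real.pi * r := by
      have : (0 : ℝ) < r := by exact_mod_cast hr
      positivity
    obtain ⟨hc, hs⟩ := hK r hr
    have hK' : K / (2 * Real.pi * r) ^ (m + 1 + 1) = K / (2 * Real.pi * r) ^ (m + 1) / (2 * Real.pi * r) := by
      rw [pow_succ, div_div]
    constructor
    · rw [integral_mul_cos_eq_ibp hφ hr, abs_div, abs_neg, abs_of_pos hw, hK',
        div_le_div_iff_of_pos_right hw]
      exact hs
    · rw [integral_mul_sin_eq_ibp hφ hr, h0, sub_self, neg_zero, zero_add, abs_div, abs_of_pos hw, hK',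
        div_le_div_iff_of_pos_right hw]
      exact hc

/-- Iterated derivatives of the Bernoulli functions: `B_q^{(j)} = q(q-1)⋯(q-j+1) B_{q-j}`. [folklore] -/
private theorem iteratedDeriv_bernoulliFun (j : ℕ) : ∀ (q : ℕ) (x : ℝ),
    iteratedDeriv j (bernoulliFun q) x = (q.descFactorial j : ℝ) * bernoulliFun (q - j) x := by
  induction j with
  | zero => intro q x; simp
  | succ j ih =>
    intro q x
    rw [iteratedDeriv_succ']
    have hderiv : deriv (bernoulliFun q) = fun y : ℝ => (q : ℝ) * bernoulliFun (q - 1) y := by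
      funext y
      exact (hasDerivAt_bernoulliFun q y).deriv
    rw [hderiv, iteratedDeriv_const_mul_field, ih]
    rcases q with _ | q
    · simp
    · rw [Nat.succ_descFactorial_succ, Nat.add_sub_cancel, Nat.add_sub_add_right]
      push_cast
      ring

/-- `B_q^{(j)}(1) - B_q^{(j)}(0) = q^{(j)} [q - j = 1]`. [folklore] -/
private theorem iteratedDeriv_bernoulliFun_one_sub_zero (j q : ℕ) :
    iteratedDeriv j (bernoulliFun q) 1 - iteratedDeriv j (bernoulliFun q) 0 =
      (q.descFactorial j : ℝ) * (if q - j = 1 then 1 else 0) := by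
  rw [iteratedDeriv_bernoulliFun, iteratedDeriv_bernoulliFun, bernoulliFun_eval_one]
  ring

/-- Each term of `h_{p-1}` is smooth. [folklore] -/
private theorem contDiff_lanczosPoly_term (f : ℝ → ℝ) (q : ℕ) :
    ContDiff ℝ ∞ (fun x : ℝ => lanczosLambda f q * bernoulliFun q x / (q.factorial : ℝ)) :=
  (contDiff_const.mul ((contDiff_bernoulliFun (k := q)).of_le le_top)).div_const _

/-- `h_{p-1}` is smooth. [folklore] -/
private theorem contDiff_lanczosPoly (f : ℝ → ℝ) (p : ℕ) : ContDiff ℝ ∞ (lanczosPoly f p) := by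
  unfold lanczosPoly
  exact ContDiff.sum fun q _ => contDiff_lanczosPoly_term f q

/-- The endpoint jumps of the derivatives of `h_{p-1}`: for `j + 1 < p`,
`h_{p-1}^{(j)}(1) - h_{p-1}^{(j)}(0) = λ_{j+1} = f^{(j)}(1) - f^{(j)}(0)`. [folklore] -/
private theorem iteratedDeriv_lanczosPoly_one_sub_zero (f : ℝ → ℝ) {p j : ℕ} (hj : j + 1 < p) :
    iteratedDeriv j (lanczosPoly f p) 1 - iteratedDeriv j (lanczosPoly f p) 0 =
      iteratedDeriv j f 1 - iteratedDeriv j f 0 := by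
  have hterm : ∀ (q : ℕ) (y : ℝ), iteratedDeriv j (fun x : ℝ => lanczosLambda f q * bernoulliFun q x /
      (q.factorial : ℝ)) y = lanczosLambda f q / (q.factorial : ℝ) * iteratedDeriv j (bernoulliFun q) y := by
    intro q y
    rw [show (fun x : ℝ => lanczosLambda f q * bernoulliFun q x / (q.factorial : ℝ)) =
        fun x : ℝ => lanczosLambda f q / (q.factorial : ℝ) * bernoulliFun q x from funext fun x => by ring,
      iteratedDeriv_const_mul_field]
  have hsum : ∀ y : ℝ, iteratedDeriv j (lanczosPoly f p) y =
      ∑ q ∈ Finset.Ico 1 p, lanczosLambda f q / (q.factorial : ℝ) * iteratedDeriv j (bernoulliFun q) y := by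
    intro y
    unfold lanczosPoly
    rw [iteratedDeriv_fun_sum (fun q _ => (contDiff_lanczosPoly_term f q).contDiffAt.of_le (mod_cast le_top))]
    exact Finset.sum_congr rfl fun q _ => hterm q y
  rw [hsum, hsum, ← Finset.sum_sub_distrib]
  have hrw : ∀ q ∈ Finset.Ico 1 p, lanczosLambda f q / (q.factorial : ℝ) * iteratedDeriv j (bernoulliFun q) 1 -
      lanczosLambda f q / (q.factorial : ℝ) * iteratedDeriv j (bernoulliFun q) 0 =
      lanczosLambda f q / (q.factorial : ℝ) * ((q.descFactorial j : ℝ) * (if q - j = 1 then 1 else 0)) := by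
    intro q _
    rw [← mul_sub, iteratedDeriv_bernoulliFun_one_sub_zero]
  rw [Finset.sum_congr rfl hrw, Finset.sum_eq_single_of_mem (j + 1) (by simp; omega)]
  · rw [if_pos (by omega), mul_one]
    have hfac : ((j + 1).descFactorial j : ℝ) = ((j + 1).factorial : ℝ) := by
      have h := Nat.factorial_mul_descFactorial (Nat.le_succ j)
      rw [Nat.succ_sub (le_refl j), Nat.sub_self, Nat.factorial_one, one_mul] at h
      exact_mod_cast h
    rw [hfac, div_mul_cancel₀ _ (by positivity)]
    simp [lanczosLambda]
  · intro q _ hq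
    rw [if_neg (by omega), mul_zero, mul_zero]

/-- `g_p` is smooth when `f` is. [folklore] -/
private theorem contDiff_lanczosRemainder {f : ℝ → ℝ} (hf : ContDiff ℝ ∞ f) (p : ℕ) :
    ContDiff ℝ ∞ (lanczosRemainder f p) := by
  unfold lanczosRemainder
  exact hf.sub (contDiff_lanczosPoly f p)

/-- The derivatives of `g_p` of order `j ≤ p - 2` have equal values at `0` and `1`. [folklore] -/
private theorem iteratedDeriv_lanczosRemainder_match {f : ℝ → ℝ} (hf : ContDiff ℝ ∞ f) {p j : ℕ}
    (hj : j + 1 < p) :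
    iteratedDeriv j (lanczosRemainder f p) 1 = iteratedDeriv j (lanczosRemainder f p) 0 := by
  have h : ∀ y : ℝ, iteratedDeriv j (lanczosRemainder f p) y =
      iteratedDeriv j f y - iteratedDeriv j (lanczosPoly f p) y := by
    intro y
    unfold lanczosRemainder
    exact iteratedDeriv_fun_sub (hf.contDiffAt.of_le (mod_cast le_top))
      ((contDiff_lanczosPoly f p).contDiffAt.of_le (mod_cast le_top))
  rw [h, h]
  linarith [iteratedDeriv_lanczosPoly_one_sub_zero f hj]

/-- **Lyness's decay statement, PROVED**: for `f` smooth (here: `ContDiff ℝ ⊤ f`) and `p ≥ 2`, the Fourier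
coefficients of `g_p = f - h_{p-1}` satisfy `|C_r g_p|, |S_r g_p| ≤ C/r^p` (`r ≥ 1`). The derivatives of
`g_p` of orders `≤ p - 2` agree at `0` and `1` (`B_m(1) - B_m(0) = [m = 1]`), so `p` integrations by parts,
the first `p - 1` without boundary terms, give the bound. Discharge of the named fact
`LanczosRemainderDecay`. [cite: DavisRabinowitz1984, Sect. 2.10.8 (2.10.8.3)-(2.10.8.4)] -/
theorem LanczosRemainderDecay_holds : ∀ (f : ℝ → ℝ) (p : ℕ), LanczosRemainderDecay f p := by
  intro f p hf hp
  have hf' : ContDiff ℝ ∞ f := hf.of_le le_top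
  obtain ⟨K, hK⟩ := fourier_unit_decay (p - 1) (lanczosRemainder f p) (contDiff_lanczosRemainder hf' p)
    (fun j hj => iteratedDeriv_lanczosRemainder_match hf' (by omega))
  have hp1 : p - 1 + 1 = p := by omega
  refine ⟨2 * K / (2 * Real.pi) ^ p, fun r hr => ?_⟩
  obtain ⟨hc, hs⟩ := hK r hr
  rw [hp1] at hc hs
  have hr0 : (r : ℕ) ≠ 0 := by omega
  have hrpos : (0 : ℝ) < r := by exact_mod_cast hr
  have hsplit : 2 * K / (2 * Real.pi) ^ p / (r : ℝ) ^ p = 2 * (K / (2 * Real.pi * r) ^ p) := by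
    field_simp
    ring
  rw [hsplit]
  constructor
  · rw [unitCosCoeff, if_neg hr0, abs_mul, abs_two]
    exact mul_le_mul_of_nonneg_left hc (by norm_num)
  · rw [unitSinCoeff, if_neg hr0, abs_mul, abs_two]
    exact mul_le_mul_of_nonneg_left hs (by norm_num)

end LanczosRemainderDecayProof

/-! ## Proof of (2.10.8.8) (`LanczosJSmallGamma_holds`)

The analytic generating function of the Bernoulli numbers on `|z| < 2π` is already in the tree
(`Literature/ComputerArithmetic/BrentZimmermann2010/ContourIntegration.lean`: `hasSum_bernoulliGen`,
`Σ_l a_l z^l = z/(e^z - 1) + z/2` with `a_l = B_l/l!` for `l ≠ 1`, `a_1 = 0`). Shifting that series by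
`q + 1` gives the tail sum of (2.10.8.8), and (2.10.8.7) (`LanczosJFormula_holds`) with the identity
`(1 - e^{-γ})(γ/(e^γ - 1) + γ/2) = γ(1 + e^{-γ})/2` identifies `J_q(γ)` with `-(1 - e^{-γ})` times it.
-/

section LanczosJSmallGammaProof

open Literature.ComputerArithmetic.BrentZimmermann2010.ContourIntegration

/-- The partial sum `Σ_{i ≤ q} a_i γ^i` of the Bernoulli generating function equals the even-`l` sum
`Σ_{l ≤ q, l even} (B_l/l!) γ^l` appearing in (2.10.8.7). [folklore] -/
private theorem sum_bernoulliCoeff_eq (q : ℕ) (γ : ℂ) :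
    ∑ i ∈ range (q + 1), bernoulliCoeff i * γ ^ i =
      ∑ l ∈ (range (q + 1)).filter Even, (bernoulli l : ℂ) / (l.factorial : ℂ) * γ ^ l := by
  rw [Finset.sum_filter]
  refine Finset.sum_congr rfl fun i _ => ?_
  unfold bernoulliCoeff
  split_ifs with h
  · push_cast; ring
  · rw [zero_mul]

/-- **(2.10.8.8), PROVED** (discharge of the named fact `LanczosJSmallGamma`): for `q ≥ 1` and
`0 < |γ| < 2π`, `J_q(γ) = -(1 - e^{-γ}) Σ_{l ≥ q+1} (B_l/l!) γ^{l-q-1}`, the series converging absolutely.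
Proof: the tree's analytic Bernoulli generating function `Σ_l a_l z^l = z/(e^z - 1) + z/2` on `|z| < 2π`
(`hasSum_bernoulliGen`, `bernoulliGen_eq`, with `a_l = B_l/l!` for `l ≠ 1`, `a_1 = 0`) gives the tail sum
`s = (f(γ) - Σ_{l ≤ q even} (B_l/l!)γ^l)/γ^{q+1}`, and (2.10.8.7) (`LanczosJFormula_holds`) together with
`(1 - e^{-γ})(γ/(e^γ-1) + γ/2) = γ(1 + e^{-γ})/2` gives `J_q(γ) = -(1 - e^{-γ}) s`.
[cite: DavisRabinowitz1984, Sect. 2.10.8 (2.10.8.8)] -/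
theorem LanczosJSmallGamma_holds : ∀ (q : ℕ) (γ : ℂ), LanczosJSmallGamma q γ := by
  intro q γ hq hγ hnorm
  have hG := hasSum_bernoulliGen hnorm
  -- shift the generating series by `q + 1`
  have hshift := (hasSum_nat_add_iff' (f := fun l => bernoulliCoeff l * γ ^ l) (q + 1)).mpr hG
  have hγq : γ ^ (q + 1) ≠ 0 := pow_ne_zero _ hγ
  set s : ℂ := (bernoulliGen γ - ∑ i ∈ range (q + 1), bernoulliCoeff i * γ ^ i) / γ ^ (q + 1) with hs
  refine ⟨s, ?_, ?_⟩
  · have h := hshift.div_const (γ ^ (q + 1))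
    refine h.congr_fun fun l => ?_
    rw [bernoulliCoeff_eq (by omega), pow_add]
    push_cast
    field_simp
  · rw [LanczosJFormula_holds q γ hq hγ, lanczosJRHS, hs, sum_bernoulliCoeff_eq, bernoulliGen_eq hnorm hγ]
    have he : Complex.exp γ - 1 ≠ 0 := by
      intro h
      have h1 : Complex.exp γ = 1 := sub_eq_zero.1 h
      obtain ⟨n, hn⟩ := Complex.exp_eq_one_iff.1 h1
      rcases eq_or_ne n 0 with rfl | hn0
      · simp at hn; exact hγ hn
      · have : 2 * Real.pi ≤ ‖γ‖ := by
          rw [hn, norm_mul, norm_mul, Complex.norm_intCast, Complex.norm_I, mul_one, Complex.norm_mul,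
            Complex.norm_ofNat, Complex.norm_real, Real.norm_eq_abs, abs_of_pos Real.pi_pos]
          have : (1 : ℝ) ≤ |(n : ℝ)| := by
            rw [← Int.cast_abs]; exact_mod_cast Int.one_le_abs hn0
          nlinarith [Real.pi_pos]
        linarith
    have he' : Complex.exp (-γ) = (Complex.exp γ)⁻¹ := Complex.exp_neg γ
    have he0 : Complex.exp γ ≠ 0 := Complex.exp_ne_zero γ
    -- reduce to the scalar identity
    set P : ℂ := ∑ l ∈ (range (q + 1)).filter Even, (bernoulli l : ℂ) / (l.factorial : ℂ) * γ ^ l with hP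
    have hsum : ∑ l ∈ (range (q + 1)).filter Even, (bernoulli l : ℂ) / (l.factorial : ℂ) * γ ^ ((l : ℤ) - q - 1) =
        P / γ ^ (q + 1) := by
      rw [hP, Finset.sum_div]
      refine Finset.sum_congr rfl fun l _ => ?_
      rw [show (l : ℤ) - q - 1 = (l : ℤ) - ((q + 1 : ℕ) : ℤ) by push_cast; ring, zpow_sub₀ hγ, zpow_natCast,
        zpow_natCast]
      ring
    rw [hsum, he', zpow_neg, zpow_natCast]
    field_simp
    ring

end LanczosJSmallGammaProof

end Literature.Analysis.Quadrature
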